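import Summits.ABC.ABC.Theorems.IsogenyGlueCongruenceSharpDegreeOfPolyDegreeRelocation
import Summits.ABC.ABC.Theorems.SharpDegreeOfPolyDegree.Negative.ExponentFloor

set_option linter.dupNamespace false

/-!
# Crux `SharpDegreeOfPolyDegree` (stmt-ABC-10895), line `Sketch`: the ξ-side exponent floor

`R := SharpDegreeOfPolyDegree = (Poly → X)`; C⁺ = the residual stub of the line `Sketch` (under
Poly, `ξ(E; N/q, q) ≤ C_ε N^{2+ε}` for semistable `E/ℚ` in global minimal form and odd primes
`q ∣ N`).  The relocation theorem (`IsogenyGlueCongruenceSharpDegreeOfPolyDegreeRelocation.lean`: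
`xiSharpUnderPoly_iff_sharpDegreeOfPolyDegree`, C⁺ ⟺ R modulo `takahashi2001_thm_2_3` and
`PastenShimura2024_minimalDegree_le_163_mul`) is extended here to every exponent `θ` in place of
`2`, and combined with the landed exponent floor of the target
(`Theorems/SharpDegreeOfPolyDegree/Negative/ExponentFloor.lean`):

* `cruxWithExponent_of_xiBoundWithExponent` / `xiBoundWithExponent_of_cruxWithExponent` /
  `xiBoundWithExponent_iff_cruxWithExponent` — "Poly ⟹ `ξ ≤ C_ε N^{θ+ε}`" ⟺ "Poly ⟹
  `deg ≤ C_ε N^{θ+ε}`" at every `θ` (modulo the two facts; `⟸` needs Takahashi only).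
* **`xiBoundWithExponent_iff_not_poly_of_lt_three_halves`** — for `θ < 3/2`, UNCONDITIONALLY in the
  analytic input, "Poly ⟹ `ξ ≤ C_ε N^{θ+ε}`" holds iff Poly fails (Masser + Iwaniec + Zagier +
  Silverman); `…_of_lt_two` — the same for `θ < 2` modulo the route item `PeterssonLowerBound`.
* `exists_brandtXi_gt_of_lt_three_halves` / `_of_lt_two` — positive form: under Poly (and the two
  facts) the definite congruence numbers `ξ(E; N/q, q)` exceed `C · N^θ` for some semistable `E`
  and odd prime `q ∣ N`, for every `C` and every `θ < 3/2` (resp. `θ < 2`).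

So the exponent `2` of C⁺ is exactly as sharp as the `2` of `X`: the residual stub has no slack, and
any line through C⁺ must improve a polynomial exponent to `2 + ε` — the abc-strength step itself.
This support file lands `--supports stmt-ABC-10895`; theorems only.
-/

noncomputable section

namespace Summit.ABC.ABC.Theorems.SharpDegreeOfPolyDegree

open Summit.ABC.ABC.Theses.IsogenyGlueCongruence
open Literature.NumberTheory.EllipticCurves Literature.NumberTheory.EllipticCurves.ModularForms
open Literature.NumberTheory.DiophantineGeometry Literature.NumberTheory.Automorphic
open WeierstrassCurve

/-! ## The same at every exponent, and the ξ-side exponent floor -/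

/-- **C⁺ with exponent `θ` ⟹ the crux with exponent `θ`**: granted the two named facts,
"Poly ⟹ `∀ ε > 0 ∃ C, ξ(E; N/q, q) ≤ C N^{θ+ε}`" implies "Poly ⟹ `∀ ε > 0 ∃ C, deg ≤ C N^{θ+ε}`".
[cite: Takahashi2001, Thm. 2.3] [cite: PastenShimura2024, §3 p. 13] -/
theorem cruxWithExponent_of_xiBoundWithExponent (hT : takahashi2001_thm_2_3)
    (h163 : PastenShimura2024_minimalDegree_le_163_mul) {θ : ℝ}
    (hC : (∃ κ C : ℝ, ∀ (W : WeierstrassCurve ℚ) [W.IsElliptic] [W.IsGloballyMinimal]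
      [NeZero (W.conductorNorm ℤ)], W.IsSemistable ℤ →
        ∃ D : ModularParametrizationData W (W.conductorNorm ℤ),
          (D.modularDegree : ℝ) ≤ C * (W.conductorNorm ℤ : ℝ) ^ κ) →
      ∀ ε : ℝ, 0 < ε → ∃ C : ℝ, ∀ (W : WeierstrassCurve ℚ) [W.IsElliptic] [W.IsGloballyMinimal]
        [NeZero (W.conductorNorm ℤ)], W.IsSemistable ℤ → ∀ q : ℕ, q.Prime → q ≠ 2 →
          q ∣ W.conductorNorm ℤ →
            (brandtXi (W.conductorNorm ℤ / q) q (fun n => W.LFunction n) : ℝ) ≤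
              C * (W.conductorNorm ℤ : ℝ) ^ (θ + ε))
    (hPoly : ∃ κ C : ℝ, ∀ (W : WeierstrassCurve ℚ) [W.IsElliptic] [W.IsGloballyMinimal]
      [NeZero (W.conductorNorm ℤ)], W.IsSemistable ℤ →
        ∃ D : ModularParametrizationData W (W.conductorNorm ℤ),
          (D.modularDegree : ℝ) ≤ C * (W.conductorNorm ℤ : ℝ) ^ κ) :
    ∀ ε : ℝ, 0 < ε → ∃ C : ℝ, ∀ (W : WeierstrassCurve ℚ) [W.IsElliptic] [W.IsGloballyMinimal]
      [NeZero (W.conductorNorm ℤ)], W.IsSemistable ℤ →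
        ∃ D : ModularParametrizationData W (W.conductorNorm ℤ),
          (D.modularDegree : ℝ) ≤ C * (W.conductorNorm ℤ : ℝ) ^ (θ + ε) := by
  intro ε hε
  obtain ⟨C₁, hC₁⟩ := hC hPoly (ε / 2) (by positivity)
  exact degreeBound_of_brandtXiBound hT h163 hPoly hC₁ (η := ε / 2) (by positivity) (by ring)

/-- **The crux with exponent `θ` ⟹ C⁺ with exponent `θ`**, from `takahashi2001_thm_2_3` alone.
[cite: Takahashi2001, Thm. 2.3] -/
theorem xiBoundWithExponent_of_cruxWithExponent (hT : takahashi2001_thm_2_3) {θ : ℝ}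
    (hR : (∃ κ C : ℝ, ∀ (W : WeierstrassCurve ℚ) [W.IsElliptic] [W.IsGloballyMinimal]
      [NeZero (W.conductorNorm ℤ)], W.IsSemistable ℤ →
        ∃ D : ModularParametrizationData W (W.conductorNorm ℤ),
          (D.modularDegree : ℝ) ≤ C * (W.conductorNorm ℤ : ℝ) ^ κ) →
      ∀ ε : ℝ, 0 < ε → ∃ C : ℝ, ∀ (W : WeierstrassCurve ℚ) [W.IsElliptic] [W.IsGloballyMinimal]
        [NeZero (W.conductorNorm ℤ)], W.IsSemistable ℤ →
          ∃ D : ModularParametrizationData W (W.conductorNorm ℤ),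
            (D.modularDegree : ℝ) ≤ C * (W.conductorNorm ℤ : ℝ) ^ (θ + ε))
    (hPoly : ∃ κ C : ℝ, ∀ (W : WeierstrassCurve ℚ) [W.IsElliptic] [W.IsGloballyMinimal]
      [NeZero (W.conductorNorm ℤ)], W.IsSemistable ℤ →
        ∃ D : ModularParametrizationData W (W.conductorNorm ℤ),
          (D.modularDegree : ℝ) ≤ C * (W.conductorNorm ℤ : ℝ) ^ κ) :
    ∀ ε : ℝ, 0 < ε → ∃ C : ℝ, ∀ (W : WeierstrassCurve ℚ) [W.IsElliptic] [W.IsGloballyMinimal]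
      [NeZero (W.conductorNorm ℤ)], W.IsSemistable ℤ → ∀ q : ℕ, q.Prime → q ≠ 2 →
        q ∣ W.conductorNorm ℤ →
          (brandtXi (W.conductorNorm ℤ / q) q (fun n => W.LFunction n) : ℝ) ≤
            C * (W.conductorNorm ℤ : ℝ) ^ (θ + ε) := by
  intro ε hε
  obtain ⟨C, hC⟩ := hR hPoly (ε / 2) (by positivity)
  exact brandtXiBound_of_degreeBound hT hPoly hC (η := ε / 2) (by positivity) (by ring)

/-- **C⁺ ⟺ R at every exponent `θ`** (modulo the two named facts): `θ = 2` is
`xiSharpUnderPoly_iff_sharpDegreeOfPolyDegree`. [cite: Takahashi2001, Thm. 2.3] -/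
theorem xiBoundWithExponent_iff_cruxWithExponent (hT : takahashi2001_thm_2_3)
    (h163 : PastenShimura2024_minimalDegree_le_163_mul) (θ : ℝ) :
    ((∃ κ C : ℝ, ∀ (W : WeierstrassCurve ℚ) [W.IsElliptic] [W.IsGloballyMinimal]
      [NeZero (W.conductorNorm ℤ)], W.IsSemistable ℤ →
        ∃ D : ModularParametrizationData W (W.conductorNorm ℤ),
          (D.modularDegree : ℝ) ≤ C * (W.conductorNorm ℤ : ℝ) ^ κ) →
      ∀ ε : ℝ, 0 < ε → ∃ C : ℝ, ∀ (W : WeierstrassCurve ℚ) [W.IsElliptic] [W.IsGloballyMinimal]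
        [NeZero (W.conductorNorm ℤ)], W.IsSemistable ℤ → ∀ q : ℕ, q.Prime → q ≠ 2 →
          q ∣ W.conductorNorm ℤ →
            (brandtXi (W.conductorNorm ℤ / q) q (fun n => W.LFunction n) : ℝ) ≤
              C * (W.conductorNorm ℤ : ℝ) ^ (θ + ε)) ↔
    ((∃ κ C : ℝ, ∀ (W : WeierstrassCurve ℚ) [W.IsElliptic] [W.IsGloballyMinimal]
      [NeZero (W.conductorNorm ℤ)], W.IsSemistable ℤ →
        ∃ D : ModularParametrizationData W (W.conductorNorm ℤ),
          (D.modularDegree : ℝ) ≤ C * (W.conductorNorm ℤ : ℝ) ^ κ) →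
      ∀ ε : ℝ, 0 < ε → ∃ C : ℝ, ∀ (W : WeierstrassCurve ℚ) [W.IsElliptic] [W.IsGloballyMinimal]
        [NeZero (W.conductorNorm ℤ)], W.IsSemistable ℤ →
          ∃ D : ModularParametrizationData W (W.conductorNorm ℤ),
            (D.modularDegree : ℝ) ≤ C * (W.conductorNorm ℤ : ℝ) ^ (θ + ε)) :=
  ⟨fun h hp => cruxWithExponent_of_xiBoundWithExponent hT h163 h hp,
    fun h hp => xiBoundWithExponent_of_cruxWithExponent hT h hp⟩

/-- **ξ-side exponent floor, UNCONDITIONAL in the analytic input (`θ < 3/2`).** Granted the two named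
facts, "Poly ⟹ `∀ ε > 0 ∃ C, ξ(E; N/q, q) ≤ C N^{θ+ε}`" with `θ < 3/2` holds iff Poly FAILS: under Poly
it would give the modular-degree conjecture with exponent `θ < 3/2`, refuted by Masser's semistable
Szpiro-excess curves (`Negative.not_targetWithExponent_of_lt_three_halves`: Zagier + Iwaniec +
Silverman + Masser, all tree theorems).  So the `2` of C⁺ cannot be lowered below `3/2` for free.
[cite: Masser1990, Theorem] [cite: Takahashi2001, Thm. 2.3] -/
theorem xiBoundWithExponent_iff_not_poly_of_lt_three_halves (hT : takahashi2001_thm_2_3)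
    (h163 : PastenShimura2024_minimalDegree_le_163_mul) {θ : ℝ} (hθ : θ < 3 / 2) :
    ((∃ κ C : ℝ, ∀ (W : WeierstrassCurve ℚ) [W.IsElliptic] [W.IsGloballyMinimal]
      [NeZero (W.conductorNorm ℤ)], W.IsSemistable ℤ →
        ∃ D : ModularParametrizationData W (W.conductorNorm ℤ),
          (D.modularDegree : ℝ) ≤ C * (W.conductorNorm ℤ : ℝ) ^ κ) →
      ∀ ε : ℝ, 0 < ε → ∃ C : ℝ, ∀ (W : WeierstrassCurve ℚ) [W.IsElliptic] [W.IsGloballyMinimal]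
        [NeZero (W.conductorNorm ℤ)], W.IsSemistable ℤ → ∀ q : ℕ, q.Prime → q ≠ 2 →
          q ∣ W.conductorNorm ℤ →
            (brandtXi (W.conductorNorm ℤ / q) q (fun n => W.LFunction n) : ℝ) ≤
              C * (W.conductorNorm ℤ : ℝ) ^ (θ + ε)) ↔
    ¬ ∃ κ C : ℝ, ∀ (W : WeierstrassCurve ℚ) [W.IsElliptic] [W.IsGloballyMinimal]
        [NeZero (W.conductorNorm ℤ)], W.IsSemistable ℤ →
          ∃ D : ModularParametrizationData W (W.conductorNorm ℤ),
            (D.modularDegree : ℝ) ≤ C * (W.conductorNorm ℤ : ℝ) ^ κ :=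
  ⟨fun h hp => Negative.not_targetWithExponent_of_lt_three_halves hθ
      (cruxWithExponent_of_xiBoundWithExponent hT h163 h hp),
    fun h hp => absurd hp h⟩

/-- **Registered stub `stub_xiFloor` (the ξ-side exponent floor in arrow form):** granted the two
named facts, for every `θ < 3/2`, "Poly ⟹ `∀ ε > 0 ∃ C, ξ(E; N/q, q) ≤ C N^{θ+ε}`" holds iff Poly fails
— unconditionally in the analytic input. [cite: Masser1990, Theorem] [cite: Takahashi2001, Thm. 2.3] -/
theorem stub_xiFloor :
    takahashi2001_thm_2_3 → PastenShimura2024_minimalDegree_le_163_mul → ∀ θ : ℝ, θ < 3 / 2 →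
    (((∃ κ C : ℝ, ∀ (W : WeierstrassCurve ℚ) [W.IsElliptic] [W.IsGloballyMinimal]
      [NeZero (W.conductorNorm ℤ)], W.IsSemistable ℤ →
        ∃ D : ModularParametrizationData W (W.conductorNorm ℤ),
          (D.modularDegree : ℝ) ≤ C * (W.conductorNorm ℤ : ℝ) ^ κ) →
      ∀ ε : ℝ, 0 < ε → ∃ C : ℝ, ∀ (W : WeierstrassCurve ℚ) [W.IsElliptic] [W.IsGloballyMinimal]
        [NeZero (W.conductorNorm ℤ)], W.IsSemistable ℤ → ∀ q : ℕ, q.Prime → q ≠ 2 →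
          q ∣ W.conductorNorm ℤ →
            (brandtXi (W.conductorNorm ℤ / q) q (fun n => W.LFunction n) : ℝ) ≤
              C * (W.conductorNorm ℤ : ℝ) ^ (θ + ε)) ↔
    ¬ ∃ κ C : ℝ, ∀ (W : WeierstrassCurve ℚ) [W.IsElliptic] [W.IsGloballyMinimal]
        [NeZero (W.conductorNorm ℤ)], W.IsSemistable ℤ →
          ∃ D : ModularParametrizationData W (W.conductorNorm ℤ),
            (D.modularDegree : ℝ) ≤ C * (W.conductorNorm ℤ : ℝ) ^ κ) :=
  fun hT h163 _ hθ => xiBoundWithExponent_iff_not_poly_of_lt_three_halves hT h163 hθ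

/-- **ξ-side exponent floor modulo the route item `PeterssonLowerBound` (`θ < 2`).** Granted the two
named facts and `(f,f) ≫_ε N^{1−ε}` (Hoffstein–Lockhart), "Poly ⟹ `∀ ε > 0 ∃ C, ξ ≤ C N^{θ+ε}`" with
`θ < 2` holds iff Poly FAILS (`Negative.not_targetWithExponent_of_lt_two`): the exponent `2` of C⁺ is
optimal, exactly as the `2` of `X`. [cite: HoffsteinLockhart1994, Thm. 0.1] [cite: Takahashi2001, Thm. 2.3] -/
theorem xiBoundWithExponent_iff_not_poly_of_lt_two (hT : takahashi2001_thm_2_3)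
    (h163 : PastenShimura2024_minimalDegree_le_163_mul) (hP : PeterssonLowerBound) {θ : ℝ}
    (hθ : θ < 2) :
    ((∃ κ C : ℝ, ∀ (W : WeierstrassCurve ℚ) [W.IsElliptic] [W.IsGloballyMinimal]
      [NeZero (W.conductorNorm ℤ)], W.IsSemistable ℤ →
        ∃ D : ModularParametrizationData W (W.conductorNorm ℤ),
          (D.modularDegree : ℝ) ≤ C * (W.conductorNorm ℤ : ℝ) ^ κ) →
      ∀ ε : ℝ, 0 < ε → ∃ C : ℝ, ∀ (W : WeierstrassCurve ℚ) [W.IsElliptic] [W.IsGloballyMinimal]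
        [NeZero (W.conductorNorm ℤ)], W.IsSemistable ℤ → ∀ q : ℕ, q.Prime → q ≠ 2 →
          q ∣ W.conductorNorm ℤ →
            (brandtXi (W.conductorNorm ℤ / q) q (fun n => W.LFunction n) : ℝ) ≤
              C * (W.conductorNorm ℤ : ℝ) ^ (θ + ε)) ↔
    ¬ ∃ κ C : ℝ, ∀ (W : WeierstrassCurve ℚ) [W.IsElliptic] [W.IsGloballyMinimal]
        [NeZero (W.conductorNorm ℤ)], W.IsSemistable ℤ →
          ∃ D : ModularParametrizationData W (W.conductorNorm ℤ),
            (D.modularDegree : ℝ) ≤ C * (W.conductorNorm ℤ : ℝ) ^ κ :=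
  ⟨fun h hp => Negative.not_targetWithExponent_of_lt_two hP hθ
      (cruxWithExponent_of_xiBoundWithExponent hT h163 h hp),
    fun h hp => absurd hp h⟩

/-- **Large definite congruence numbers under Poly (unconditional range).** Granted the two named
facts and Poly, for every `C` and every `θ < 3/2` some semistable `E/ℚ` in global minimal form and
some odd prime `q ∣ N_E` have `ξ(E; N/q, q) > C · N_E^θ` — otherwise `degreeBound_of_brandtXiBound`
(with `η = (3/2 − θ)/2`) would give a degree bound with exponent `< 3/2`, refuted unconditionally
(`Negative.not_degreeBound_of_lt_three_halves`). [cite: Masser1990, Theorem] [cite: Takahashi2001, Thm. 2.3] -/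
theorem exists_brandtXi_gt_of_lt_three_halves (hT : takahashi2001_thm_2_3)
    (h163 : PastenShimura2024_minimalDegree_le_163_mul)
    (hPoly : ∃ κ C : ℝ, ∀ (W : WeierstrassCurve ℚ) [W.IsElliptic] [W.IsGloballyMinimal]
      [NeZero (W.conductorNorm ℤ)], W.IsSemistable ℤ →
        ∃ D : ModularParametrizationData W (W.conductorNorm ℤ),
          (D.modularDegree : ℝ) ≤ C * (W.conductorNorm ℤ : ℝ) ^ κ)
    {θ : ℝ} (hθ : θ < 3 / 2) (C : ℝ) :
    ∃ (W : WeierstrassCurve ℚ) (_ : W.IsElliptic) (_ : W.IsGloballyMinimal)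
      (_ : NeZero (W.conductorNorm ℤ)) (q : ℕ), W.IsSemistable ℤ ∧ q.Prime ∧ q ≠ 2 ∧
        q ∣ W.conductorNorm ℤ ∧
        C * (W.conductorNorm ℤ : ℝ) ^ θ <
          (brandtXi (W.conductorNorm ℤ / q) q (fun n => W.LFunction n) : ℝ) := by
  by_contra hcon
  push Not at hcon
  have hξ : ∀ (W : WeierstrassCurve ℚ) [W.IsElliptic] [W.IsGloballyMinimal]
      [NeZero (W.conductorNorm ℤ)], W.IsSemistable ℤ → ∀ q : ℕ, q.Prime → q ≠ 2 →
        q ∣ W.conductorNorm ℤ →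
          (brandtXi (W.conductorNorm ℤ / q) q (fun n => W.LFunction n) : ℝ) ≤
            C * (W.conductorNorm ℤ : ℝ) ^ θ :=
    fun W hE hM hN hss q hq hq2 hqN => hcon W hE hM hN q hss hq hq2 hqN
  have hη : 0 < (3 / 2 - θ) / 2 := by linarith
  obtain ⟨C', hC'⟩ := degreeBound_of_brandtXiBound hT h163 hPoly hξ hη rfl
  exact Negative.not_degreeBound_of_lt_three_halves (κ := θ + (3 / 2 - θ) / 2) (by linarith)
    ⟨C', hC'⟩

/-- **Large definite congruence numbers under Poly, modulo `PeterssonLowerBound` (`θ < 2`).**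
[cite: HoffsteinLockhart1994, Thm. 0.1] [cite: Takahashi2001, Thm. 2.3] -/
theorem exists_brandtXi_gt_of_lt_two (hT : takahashi2001_thm_2_3)
    (h163 : PastenShimura2024_minimalDegree_le_163_mul) (hP : PeterssonLowerBound)
    (hPoly : ∃ κ C : ℝ, ∀ (W : WeierstrassCurve ℚ) [W.IsElliptic] [W.IsGloballyMinimal]
      [NeZero (W.conductorNorm ℤ)], W.IsSemistable ℤ →
        ∃ D : ModularParametrizationData W (W.conductorNorm ℤ),
          (D.modularDegree : ℝ) ≤ C * (W.conductorNorm ℤ : ℝ) ^ κ)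
    {θ : ℝ} (hθ : θ < 2) (C : ℝ) :
    ∃ (W : WeierstrassCurve ℚ) (_ : W.IsElliptic) (_ : W.IsGloballyMinimal)
      (_ : NeZero (W.conductorNorm ℤ)) (q : ℕ), W.IsSemistable ℤ ∧ q.Prime ∧ q ≠ 2 ∧
        q ∣ W.conductorNorm ℤ ∧
        C * (W.conductorNorm ℤ : ℝ) ^ θ <
          (brandtXi (W.conductorNorm ℤ / q) q (fun n => W.LFunction n) : ℝ) := by
  by_contra hcon
  push Not at hcon
  have hξ : ∀ (W : WeierstrassCurve ℚ) [W.IsElliptic] [W.IsGloballyMinimal]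
      [NeZero (W.conductorNorm ℤ)], W.IsSemistable ℤ → ∀ q : ℕ, q.Prime → q ≠ 2 →
        q ∣ W.conductorNorm ℤ →
          (brandtXi (W.conductorNorm ℤ / q) q (fun n => W.LFunction n) : ℝ) ≤
            C * (W.conductorNorm ℤ : ℝ) ^ θ :=
    fun W hE hM hN hss q hq hq2 hqN => hcon W hE hM hN q hss hq hq2 hqN
  have hη : 0 < (2 - θ) / 2 := by linarith
  obtain ⟨C', hC'⟩ := degreeBound_of_brandtXiBound hT h163 hPoly hξ hη rfl
  exact Negative.not_degreeBound_of_lt_two hP (κ := θ + (2 - θ) / 2) (by linarith) ⟨C', hC'⟩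

end Summit.ABC.ABC.Theorems.SharpDegreeOfPolyDegree

end
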